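import Literature.AlgebraicGeometry.HodgeTheory.GysinKernelSNC
import Literature.AlgebraicGeometry.HodgeTheory.CorrespondenceSupportedVanishing
import Literature.AlgebraicGeometry.HodgeTheory.ComplexPointsLocallyContractible
import Literature.AlgebraicGeometry.Resolution.KollarStepThreeData
import Literature.AlgebraicGeometry.Resolution.SmoothOfRegularPerfectField
import Literature.AlgebraicGeometry.Motives.GeometricallyIntegralAlgClosed
import Literature.AlgebraicGeometry.Motives.AbelianVarietyProofs
import HarnessLib

/-!
# Deligne, *Hodge III*, Prop. 8.2.7 — the simple-normal-crossings case IS a case of the general one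

PROOF FILE (theorems only; no definitions, no named facts) for the named fact
`Deligne1974_ker_pullback_eq_ker_pullback_snc` (`GysinKernelSNC.lean`): P. Deligne, *Théorie de
Hodge III*, Publ. Math. IHÉS 44 (1974), Prop. 8.2.7 ("Soient des morphismes de schémas
`X̃ →π X →f Y`. On suppose que `Y` est lisse, que `X` est propre, que `X̃` est propre et lisse et
que `π` est surjectif. Alors, les noyaux de `f^*` et de `(fπ)^*` dans `Hⁿ(Y, ℚ)` sont égaux",
p. 40), in the case `Y` smooth projective, `X = ⋃ᵢ V(Dᵢ)` the union of the members of a simple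
normal crossings boundary `E = (Dᵢ)` on `Y` and `X̃ = ⊔ᵢ V(Dᵢ)`, in the tree's Čech rendering.

This file records, as a theorem, the sentence of the fact's docstring "exactly like the general
named fact `Deligne1974_ker_pullback_eq_ker_pullback_resolution`, of which this is the special
case": `Deligne1974_ker_pullback_eq_ker_pullback_snc_of_resolution`. The reduction is the one
Deligne's statement itself performs (take for `X̃ → X` ANY proper surjection from a smooth proper
scheme): the members `V(D)`, `D ∈ E`, of an snc boundary on a smooth projective `Y` are regular
schemes (`Resolution.HasSNCWith.isRegular_subscheme`, after splitting every member into its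
irreducible components, which are pairwise disjoint and again form an snc boundary,
`Resolution.HasSNCWith.split` / `Resolution.Kollar2007.boundaryPieces`,
[BierstoneGrigorievMilmanWlodarczyk2011, §4 Step 2]); a regular scheme of finite type over the
perfect field `ℂ` is smooth (`Resolution.smooth_of_isRegular_of_perfectField`,
[Matsumura1987, §30]); a closed subscheme of a projective scheme is projective; an integral
`ℂ`-scheme is geometrically integral. So the components `Y_c ↪ Y` of the members form a finite
family of closed immersions of smooth projective varieties with `⋃ c, Y_c = ⋃_{D ∈ E} V(D)`
(`exists_family_of_hasSNC`), every `Y_c(ℂ) → Y(ℂ)` factors through the complex points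
`{Q | pt Q ∈ V(D)}` of the member containing it, so a class dying on every `{Q | pt Q ∈ V(D)}`
dies under every `(Y_c ↪ Y)(ℂ)^*` (`complexBetti_map_eq_zero_of_range_subset`), and the general
fact gives the open neighbourhood of `{Q | pt Q ∈ ⋃ c, Y_c} = {Q | pt Q ∈ ⋃_{D ∈ E} V(D)}` on
which it dies.

Consequently the snc fact carries no mathematical debt beyond the general one (whose residual
content is Deligne's mixed Hodge theory: `Motives.MixedHodgeStructureOfPair.existsDeligne` with
Prop. 8.2.5, see `GysinKernelSplitProofs`); a Hodge-free proof of either does not exist (the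
statement fails for `C^∞` configurations: two transverse circles of the same class on a real
`2`-torus meeting in four points carry a class of `H¹(T²)` dying on each circle but not on their
union), and the intended independent road to the snc case is the "principle of two types"
(Deligne–Griffiths–Morgan–Sullivan 1975 §5–§6; the tree's `Algebra/Homology/DDbarCechZigzag` and
`NumberTheory/Transcendental/KaehlerDDbarLemmaProofs`), which needs the analytification of `Y` and
of the strata as compact Kähler manifolds with a natural de Rham comparison.

Main results:

* `complexBetti_map_eq_zero_of_range_subset` — a class dying on `{Q | pt Q ∈ S}` is killed by
  `g(ℂ)^*` for every morphism `g` with set-theoretic image inside `S`;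
* `exists_family_of_hasSNC` — the components of the members of an snc boundary on a smooth
  projective complex variety, as closed immersions of smooth projective varieties, with the
  bookkeeping between supports and images;
* `Deligne1974_ker_pullback_eq_ker_pullback_snc_of_resolution` — the snc case from the general
  named fact;
* `Deligne1974_ker_pullback_eq_ker_pullback_snc_iff_restrict` — the Čech rendering ("dies on an
  open neighbourhood of `{Q | pt Q ∈ ⋃ V(D)}`") is equivalent to the restriction rendering ("dies
  on `{Q | pt Q ∈ ⋃ V(D)}`"), by the tautness of complex algebraic sets (proved in the tree);
* `Deligne1974_ker_pullback_eq_ker_pullback_snc.singleton` — the one-member case, unconditionally.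

## References

* [DeligneHodgeIII1974] P. Deligne, Théorie de Hodge III, Publ. Math. IHÉS 44 (1974), Prop. 8.2.7
  (p. 40).
* [BierstoneGrigorievMilmanWlodarczyk2011] E. Bierstone, D. Grigoriev, P. Milman, J. Włodarczyk,
  Effective Hironaka resolution and its complexity, Asian J. Math. 15 (2011), Def. 3.1.1,
  §4 Step 2.
* [Matsumura1987] H. Matsumura, Commutative Ring Theory (1987), §30 (regular ⇒ smooth over a
  perfect field).
* [Hartshorne1977] R. Hartshorne, Algebraic Geometry (1977), II.4 (closed immersions are
  projective), II Ex. 4.9.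
* [SerreGAGA1956] J.-P. Serre, Géométrie algébrique et géométrie analytique, Ann. Inst. Fourier 6
  (1956), §2 (complex points of a closed subscheme).
* [Spanier1981] E. H. Spanier, Algebraic Topology, Springer 1981, Ch. 6 §1 Thm. 10 (tautness).
-/

noncomputable section

open CategoryTheory AlgebraicGeometry TopologicalSpace
open Literature.AlgebraicTopology.SingularHomology
open Literature.AlgebraicGeometry.Resolution Literature.AlgebraicGeometry.Motives

namespace Literature.AlgebraicGeometry.HodgeTheory

/-! ### A class dying on the complex points over `S ⊇ g(Y)` is killed by `g(ℂ)^*` -/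

/-- **Restriction then pull-back.** If `g : Y ⟶ X` has set-theoretic image inside `S ⊆ X`, the
continuous map `g(ℂ) : Y(ℂ) → X(ℂ)` factors through the subspace `{Q | pt Q ∈ S}` (because
`pt (g(ℂ) P) = g (pt P)`, `AlgPoints.pt_map`), so `g(ℂ)^* x' = 0` for every class `x'` whose
restriction to `{Q | pt Q ∈ S}` vanishes. [cite: SerreGAGA1956, §2] -/
theorem complexBetti_map_eq_zero_of_range_subset {X Y : SchemeOver ℂ} (g : Y ⟶ X) {q : ℕ}
    {x' : complexBetti X q} {S : Set X.left} (hS : Set.range g.left.base ⊆ S)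
    (hx : singularCohomology.map ℂ ℂ (subsetIncl {Q : ComplexPoints X | Q.pt ∈ S}) q x' = 0) :
    complexBetti.map g q x' = 0 := by
  -- the corestriction of `g(ℂ)` to `{Q | pt Q ∈ S}`
  let c : C(ComplexPoints Y, ↥({Q : ComplexPoints X | Q.pt ∈ S})) :=
    ⟨fun P ↦ ⟨AlgPoints.map (L := ℂ) g P, hS ⟨P.pt, (AlgPoints.pt_map (L := ℂ) g P).symm⟩⟩,
      (AlgPoints.continuous_map (L := ℂ) g).subtype_mk _⟩
  have hfac : AlgPoints.mapContinuous (L := ℂ) g =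
      (subsetIncl {Q : ComplexPoints X | Q.pt ∈ S}).comp c := by
    ext P
    rfl
  change singularCohomology.map ℂ ℂ (AlgPoints.mapContinuous (L := ℂ) g) q x' = 0
  rw [hfac, singularCohomology.map_comp, ModuleCat.comp_apply, hx, map_zero]

/-! ### The components of the members of an snc boundary as smooth projective subvarieties -/

/-- **The irreducible components of the members of an snc boundary on a smooth projective
complex variety, as closed immersions of smooth projective varieties.** Split every member `K`
of `E` into its irreducible components (`Kollar2007.boundaryPieces`; the split list still has
simple normal crossings, `HasSNCWith.split`); a component `Zc`, with its reduced structure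
(`ClosedSubvariety.ofPoint` of its generic point), is a member of the split boundary, hence a
REGULAR scheme (`HasSNCWith.isRegular_subscheme`), hence smooth over `ℂ`
(`smooth_of_isRegular_of_perfectField`), of some relative dimension (irreducible source,
`exists_smoothOfRelativeDimension_of_smooth`), projective (closed in `X`,
`isProjectiveOver_toSchemeOver`) and geometrically irreducible (integral over `ℂ = ℂ̄`,
`geometricallyIntegral_of_isAlgClosed`). Returned: the finite family `g c : Y c ⟶ X` of closed
immersions, `⋃_{D ∈ E} V(D) = ⋃ c, g_c(Y c)`, and for every `c` a member `D ∈ E` with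
`g_c(Y c) ⊆ V(D)`. (This is the scheme-theoretic half of Deligne's "`X̃` propre et lisse, `π`
surjectif" for `X̃ = ⊔ V(Dᵢ) → ⋃ V(Dᵢ)`.)
[cite: BierstoneGrigorievMilmanWlodarczyk2011, §4 Step 2 (p. 12)]
[cite: Matsumura1987, §30 Remark 2 after Thm. 30.3] [cite: Hartshorne1977, II Ex. 4.9] -/
theorem exists_family_of_hasSNC {n : ℕ} {X : SchemeOver ℂ} (hX : IsSmoothProjective n X)
    (E : List X.left.IdealSheafData) (hE : HasSNC E) :
    ∃ (ι : Type) (_ : Finite ι) (m : ι → ℕ) (Y : ι → SchemeOver ℂ)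
      (_ : ∀ i, IsSmoothProjective (m i) (Y i)) (g : ∀ i, Y i ⟶ X),
      (∀ i, IsClosedImmersion (g i).left) ∧
      (⋃ D ∈ E, ((D.support : Set X.left))) = ⋃ i, Set.range (g i).left.base ∧
      (∀ i, ∃ D ∈ E, Set.range (g i).left.base ⊆ ((D.support : Set X.left))) := by
  classical
  -- instances on `X`
  haveI := hX.smoothOfRelativeDimension
  haveI : Smooth X.hom := SmoothOfRelativeDimension.smooth n X.hom
  haveI : IsLocallyNoetherian X.left := IsSmoothProjective.isLocallyNoetherian_holds hX
  haveI : NoetherianSpace X.left := noetherianSpace_of_isSmoothProjective hX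
  -- the split boundary
  set Es : List X.left.IdealSheafData :=
    E.flatMap fun K => pieceIdeals (Kollar2007.boundaryPieces K) with hEsdef
  have hEs : HasSNC Es := hE.split _ fun K hK => hE.isPiecePartition_boundaryPieces hK
  -- the index set: the components of the members
  set S : Set (Closeds X.left) := {Zc | ∃ K ∈ E, Zc ∈ Kollar2007.boundaryPieces K} with hSdef
  have hSfin : S.Finite := by
    have hS' : S = ⋃ K ∈ {K | K ∈ E}, {Zc | Zc ∈ Kollar2007.boundaryPieces K} := by
      ext Zc; simp [hSdef]
    rw [hS']
    exact (List.finite_toSet E).biUnion fun K _ => List.finite_toSet _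
  -- each component as a smooth projective subvariety
  have key : ∀ Zc ∈ S, ∃ (m : ℕ) (Y : SchemeOver ℂ) (_ : IsSmoothProjective m Y) (g : Y ⟶ X)
      (_ : IsClosedImmersion g.left), Set.range g.left.base = (Zc : Set X.left) := by
    rintro Zc ⟨K, hK, hZc⟩
    have hcomp := Kollar2007.mem_boundaryPieces_iff.mp hZc
    have hirr : IsIrreducible (Zc : Set X.left) := componentsIn.isIrreducible hcomp
    -- the generic point and the reduced closed subscheme structure
    set η : X.left := hirr.genericPoint with hηdef
    have hηcl : closure ({η} : Set X.left) = Zc := hirr.closure_genericPoint Zc.isClosed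
    set W := ClosedSubvariety.ofPoint X.left η with hWdef
    -- `W` is regular: it is the member `I(Zc)` of the snc boundary `Es`
    have hPmem : Scheme.IdealSheafData.vanishingIdeal Zc ∈ Es :=
      List.mem_flatMap.mpr ⟨K, hK, mem_pieceIdeals_iff.mpr ⟨Zc, hZc, rfl⟩⟩
    have hregP : Scheme.IsRegular (Scheme.IdealSheafData.vanishingIdeal Zc).subscheme :=
      (hEs.hasSNCWith_self _ hPmem).isRegular_subscheme
    have hcl : (⟨closure ({η} : Set X.left), isClosed_closure⟩ : Closeds X.left) = Zc :=
      Closeds.ext hηcl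
    have hregW : Scheme.IsRegular W.carrier := by
      change Scheme.IsRegular
        (Scheme.IdealSheafData.vanishingIdeal
          (⟨closure ({η} : Set X.left), isClosed_closure⟩ : Closeds X.left)).subscheme
      rw [hcl]
      exact hregP
    -- `W` over `ℂ`: smooth of some relative dimension `m`, projective, geometrically irreducible
    haveI : IsClosedImmersion W.ιOver.left := inferInstanceAs (IsClosedImmersion W.ι)
    haveI : LocallyOfFiniteType W.toSchemeOver.hom :=
      inferInstanceAs (LocallyOfFiniteType (W.ι ≫ X.hom))
    haveI : Smooth W.toSchemeOver.hom := smooth_of_isRegular_of_perfectField _ hregW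
    haveI : IrreducibleSpace W.toSchemeOver.left := inferInstanceAs (IrreducibleSpace W.carrier)
    haveI : IsIntegral W.toSchemeOver.left := inferInstanceAs (IsIntegral W.carrier)
    obtain ⟨m, hm⟩ := exists_smoothOfRelativeDimension_of_smooth W.toSchemeOver.hom
    have hproj : IsProjectiveOver W.toSchemeOver :=
      isProjectiveOver_toSchemeOver W hX.isProjectiveOver
    haveI := geometricallyIntegral_of_isAlgClosed W.toSchemeOver.hom
    have hgi : GeometricallyIrreducible W.toSchemeOver.hom := inferInstance
    have hY : IsSmoothProjective m W.toSchemeOver := ⟨hm, hproj, hgi⟩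
    -- the image is `Zc`
    have hrange : Set.range W.ιOver.left.base = (Zc : Set X.left) := by
      rw [← hηcl]
      exact ClosedSubvariety.range_ofPoint_ι (X := X.left) η
    exact ⟨m, W.toSchemeOver, hY, W.ιOver, inferInstance, hrange⟩
  choose m Y hY g hg hrange using key
  -- assemble, indexed by the subtype of `S`
  refine ⟨S, hSfin.to_subtype, fun i => m i.1 i.2, fun i => Y i.1 i.2, fun i => hY i.1 i.2,
    fun i => g i.1 i.2, fun i => hg i.1 i.2, ?_, ?_⟩
  · -- `⋃ V(D) = ⋃ images`
    ext x
    simp only [Set.mem_iUnion, Set.mem_range]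
    constructor
    · rintro ⟨D, hD, hx⟩
      obtain ⟨Zc, hZc, hxZ⟩ := (hE.isPiecePartition_boundaryPieces hD).exists_mem hx
      refine ⟨⟨Zc, D, hD, hZc⟩, ?_⟩
      have : x ∈ Set.range (g Zc ⟨D, hD, hZc⟩).left.base := by rw [hrange]; exact hxZ
      exact this
    · rintro ⟨⟨Zc, D, hD, hZc⟩, hx⟩
      have hx' : x ∈ (Zc : Set X.left) := by rw [← hrange Zc ⟨D, hD, hZc⟩]; exact hx
      exact ⟨D, hD, (hE.isPiecePartition_boundaryPieces hD).subset hZc hx'⟩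
  · -- every `g i` lands in a member of `E`
    rintro ⟨Zc, K, hK, hZc⟩
    refine ⟨K, hK, ?_⟩
    rw [hrange Zc ⟨K, hK, hZc⟩]
    exact (hE.isPiecePartition_boundaryPieces hK).subset hZc

/-! ### The snc case from the general fact -/

/-- **Deligne, *Hodge III*, Prop. 8.2.7: the simple-normal-crossings case follows from the general
named fact `Deligne1974_ker_pullback_eq_ker_pullback_resolution`.** Given the general statement
(for every finite family `g j : Y j ⟶ X` of morphisms from smooth projective varieties, a class
killed by all `(g j)(ℂ)^*` dies on an open neighbourhood of `{P | pt P ∈ ⋃ j, g_j(Y j)}`), apply it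
to the family of components of the members of the snc boundary (`exists_family_of_hasSNC`):
a class dying on every `{Q | pt Q ∈ V(D)}`, `D ∈ E`, is killed by every `(g c)(ℂ)^*`
(`complexBetti_map_eq_zero_of_range_subset`, as `g_c(Y c) ⊆ V(D)` for some member `D`), and
`{Q | pt Q ∈ ⋃_{D ∈ E} V(D)} = {Q | pt Q ∈ ⋃ c, g_c(Y c)}`. This is Deligne's statement read with
`X̃ := ⊔ c, Y c`, "propre et lisse", `π : X̃ → ⋃ V(D)` "surjectif".
[cite: DeligneHodgeIII1974, Prop. 8.2.7 (p. 40)] -/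
theorem Deligne1974_ker_pullback_eq_ker_pullback_snc_of_resolution
    (h : Deligne1974_ker_pullback_eq_ker_pullback_resolution) :
    Deligne1974_ker_pullback_eq_ker_pullback_snc := by
  intro n X hX E hE q x' hx'
  obtain ⟨ι, hι, m, Y, hY, g, -, hU, hsub⟩ := exists_family_of_hasSNC hX E hE
  haveI := hι
  obtain ⟨V, hV, hKV, hres⟩ := h hX hY g q x' fun i => by
    obtain ⟨D, hD, hDi⟩ := hsub i
    exact complexBetti_map_eq_zero_of_range_subset (g i) hDi (hx' D hD)
  refine ⟨V, hV, fun Q hQ => hKV ?_, hres⟩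
  show Q.pt ∈ ⋃ j, Set.range (g j).left.base
  rw [← hU]
  exact hQ

/-! ### Čech form versus restriction form; the one-member case -/

/-- **The Čech rendering is equivalent to the restriction rendering.** Because `⋃_{D ∈ E} V(D)` is
Zariski-closed and the complex points of a Zariski-closed subset of a smooth projective variety
form a taut subspace (a class of `Hᵠ(X(ℂ); ℂ)` vanishing ON `{Q | pt Q ∈ Z}` vanishes NEAR it:
`exists_isOpen_map_eq_zero_of_isClosed`, Spanier Ch. 6 §1 Thm. 10 with the local contractibility
of complex algebraic sets, proved in the tree by semialgebraic triangulation), the named fact says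
exactly: `Ker (Hᵠ(X(ℂ)) → ⊕_{D ∈ E} Hᵠ(V(D)(ℂ))) = Ker (Hᵠ(X(ℂ)) → Hᵠ((⋃_{D ∈ E} V(D))(ℂ)))` —
Deligne's "les noyaux de `f^*` et de `(fπ)^*` sont égaux" for `f : ⋃ V(D) ↪ X`,
`π : ⊔ V(D) → ⋃ V(D)`. [cite: DeligneHodgeIII1974, Prop. 8.2.7 (p. 40)]
[cite: Spanier1981, Ch. 6 §1, Thm. 10] -/
theorem Deligne1974_ker_pullback_eq_ker_pullback_snc_iff_restrict :
    Deligne1974_ker_pullback_eq_ker_pullback_snc ↔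
      ∀ ⦃n : ℕ⦄ ⦃X : SchemeOver ℂ⦄, IsSmoothProjective n X →
        ∀ (E : List X.left.IdealSheafData), HasSNC E → ∀ (q : ℕ) (x' : complexBetti X q),
          (∀ D ∈ E, singularCohomology.map ℂ ℂ
            (subsetIncl {Q : ComplexPoints X | Q.pt ∈ ((D.support : Set X.left))}) q x' = 0) →
          singularCohomology.map ℂ ℂ
            (subsetIncl {Q : ComplexPoints X | Q.pt ∈ ⋃ D ∈ E, ((D.support : Set X.left))})
              q x' = 0 := by
  constructor
  · intro h n X hX E hE q x' hx'
    obtain ⟨V, -, hsub, hV⟩ := h hX E hE q x' hx'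
    have hfac : subsetIncl {Q : ComplexPoints X | Q.pt ∈ ⋃ D ∈ E, ((D.support : Set X.left))} =
        (subsetIncl V).comp (subsetInclusion hsub) := rfl
    rw [hfac, singularCohomology.map_comp, ModuleCat.comp_apply, hV, map_zero]
  · intro h n X hX E hE q x' hx'
    have hZ : IsClosed (⋃ D ∈ E, ((D.support : Set X.left))) :=
      (List.finite_toSet E).isClosed_biUnion fun D _ => D.support.isClosed
    obtain ⟨V, hV, hsub, hres⟩ := exists_isOpen_map_eq_zero_of_isClosed hX hZ x' (h hX E hE q x' hx')
    exact ⟨V, hV, fun Q hQ => hsub Q hQ, hres⟩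

/-- **The one-member case holds unconditionally** (non-vacuity of the Čech rendering): for a
single member `E = [D]` (no normal-crossings hypothesis needed, `V(D)` any closed subscheme) a
class dying on `{Q | pt Q ∈ V(D)}` dies on an open neighbourhood of it — tautness alone, no Hodge
theory; the content of Prop. 8.2.7 only appears with two or more members meeting each other.
[cite: Spanier1981, Ch. 6 §1, Thm. 10] -/
theorem Deligne1974_ker_pullback_eq_ker_pullback_snc.singleton {n : ℕ} {X : SchemeOver ℂ}
    (hX : IsSmoothProjective n X) (D : X.left.IdealSheafData) (q : ℕ) (x' : complexBetti X q)
    (hx' : singularCohomology.map ℂ ℂ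
      (subsetIncl {Q : ComplexPoints X | Q.pt ∈ ((D.support : Set X.left))}) q x' = 0) :
    ∃ V : Set (ComplexPoints X), IsOpen V ∧
      {Q : ComplexPoints X | Q.pt ∈ ⋃ D' ∈ [D], ((D'.support : Set X.left))} ⊆ V ∧
      singularCohomology.map ℂ ℂ (subsetIncl V) q x' = 0 := by
  obtain ⟨V, hV, hsub, hres⟩ :=
    exists_isOpen_map_eq_zero_of_isClosed hX D.support.isClosed x' hx'
  refine ⟨V, hV, fun Q hQ => hsub Q ?_, hres⟩
  simpa using hQ

end Literature.AlgebraicGeometry.HodgeTheory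

end
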